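import Literature.NumberTheory.EllipticCurves.IntSeriesOnePlusPowExponentLaws
import Literature.NumberTheory.EllipticCurves.IntSeriesValueNormRigidity
import Literature.NumberTheory.EllipticCurves.PAdicLFunctionInterpolationProofs
import Mathlib.Tactic
import HarnessLib

set_option autoImplicit false

/-!
# The `p`-adic binomial power: exponent multiplicativity `(1+x)^{ab} = ((1+x)^a)^b` and injectivity of
# `a ↦ (1+x)^a` for a one-unit `1 + x ≠ 1` of level `‖x‖ < ‖p‖`

Topic `NumberTheory/EllipticCurves` (receptacle `𝒪_{ℂ_p}⟦T⟧`; `IntSeries.onePlusPow c x = (1+x)^c` of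
`DeShalit1987/KatzMeasureMonomialLinesPAdic.lean`; sequel of `IntSeriesOnePlusPowExponentLaws.lean`).
Gouvêa, *p-adic Numbers* §5.9 (p. 132: `(1+x)^α := B(α, x)`; Problem 197: "the map `α ↦ u^α` … ");
Serre, *A Course in Arithmetic* II §3.2 Prop. 8 (`θ : z ↦ α^z` is an isomorphism of `ℤ_p` onto `U₁`).

* `onePlusPow_at_zero` — `(1+0)^c = 1`.
* **`onePlusPow_mul`** — `(1+x)^{a·b} = ((1+x)^a)^b`, i.e. `onePlusPow (a*b) x = onePlusPow b ((1+x)^a − 1)`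
  (both sides are continuous in `b ∈ ℤ_p` and agree on `ℕ`).
* **`onePlusPow_injective_of_norm_lt`** — for `x ≠ 0` with `‖x‖ < ‖p‖`, `a ↦ (1+x)^a` is injective on `ℤ_p`:
  `(1+x)^w = 1` with `w = p^k·v ≠ 0` would make `h = (1+x)^v` a `p^k`-th root of unity of level `< ‖p‖`,
  hence `h = 1` (`IntSeries.forall_pow_ne_one_of_norm_sub_one_lt`), hence `1 + x = h^{v⁻¹} = 1`.

USE (cell `bsd-print-cf2`, route C, «(R) period rigidity» lane of item 23722): comparing the line-wise
twist exponents `z_s` through their common node base `g` (`g^{z_s} = D_s`) needs `g^z = g^{z'} ⟹ z = z'`.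
THEOREMS ONLY (no definition, no named fact, no `sorry`).

## References

* F. Q. Gouvêa, *p-adic Numbers: An Introduction*, Universitext, Springer 1993, §5.9 (p. 132).
  [Gouvea1993PadicNumbers]
* J.-P. Serre, *A Course in Arithmetic*, GTM 7, Springer 1973, Ch. II §3.2 Prop. 8. [Serre1973]
-/

noncomputable section

open Filter Topology PowerSeries Finset

namespace Literature.NumberTheory.EllipticCurves.IntSeries

variable {p : ℕ} [Fact p.Prime]

/-- `(1+0)^c = 1`. [cite: Gouvea1993PadicNumbers, §5.9 (`(1+x)^α := B(α, x)`, p. 132)] -/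
theorem onePlusPow_at_zero (c : ℤ_[p]) : onePlusPow c (0 : ℂ_[p]) = 1 := by
  have h := norm_onePlusPow_sub_one_le c (x := (0 : ℂ_[p])) (by rw [norm_zero]; exact one_pos)
  rw [norm_zero] at h
  exact sub_eq_zero.mp (norm_le_zero_iff.mp h)

/-- `‖(1+x)^a − 1‖ < 1`: the binomial power of a point of the open disc is a one-unit.
[cite: Gouvea1993PadicNumbers, §5.9 (`(1+x)^α := B(α, x)`, p. 132)] -/
theorem norm_onePlusPow_sub_one_lt (a : ℤ_[p]) {x : ℂ_[p]} (hx : ‖x‖ < 1) :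
    ‖onePlusPow a x - 1‖ < 1 :=
  (norm_onePlusPow_sub_one_le a hx).trans_lt hx

/-- **Exponent multiplicativity `(1+x)^{a·b} = ((1+x)^a)^b`** (`‖x‖ < 1`, `a, b ∈ ℤ_p`).
[cite: Serre1973, Ch. II §3.2 Prop. 8] -/
theorem onePlusPow_mul (a b : ℤ_[p]) {x : ℂ_[p]} (hx : ‖x‖ < 1) :
    onePlusPow (a * b) x = onePlusPow b (onePlusPow a x - 1) := by
  have hx' : ‖onePlusPow a x - 1‖ < 1 := norm_onePlusPow_sub_one_lt a hx
  have hc1 : Continuous fun b : ℤ_[p] ↦ onePlusPow (a * b) x :=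
    (continuous_onePlusPow hx).comp (continuous_const.mul continuous_id)
  have hc2 : Continuous fun b : ℤ_[p] ↦ onePlusPow b (onePlusPow a x - 1) := continuous_onePlusPow hx'
  have h := PadicInt.denseRange_natCast.equalizer hc1 hc2 (funext fun n ↦ by
    simp only [Function.comp_apply]
    rw [mul_comm, onePlusPow_natCast_mul n a hx, onePlusPow_natCast, add_sub_cancel])
  exact congrFun h b

/-- **`a ↦ (1+x)^a` is injective** for `x ≠ 0` of level `‖x‖ < ‖p‖`.
[cite: Serre1973, Ch. II §3.2 Prop. 8] -/
theorem onePlusPow_injective_of_norm_lt {x : ℂ_[p]} (hx0 : x ≠ 0) (hxp : ‖x‖ < ‖(p : ℂ_[p])‖) :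
    Function.Injective fun a : ℤ_[p] ↦ onePlusPow a x := by
  have hx : ‖x‖ < 1 := hxp.trans_le norm_prime_padicComplex_lt_one.le
  intro a b hab
  simp only at hab
  by_contra hne
  have hw0 : a - b ≠ 0 := sub_ne_zero.2 hne
  -- `(1+x)^{a-b} = 1`
  have hw : onePlusPow (a - b) x = 1 := by
    rw [onePlusPow_sub a b hx, hab, mul_inv_cancel₀ (onePlusPow_ne_zero b hx)]
  -- `a - b = v · p^k` with `v` a unit
  set w : ℤ_[p] := a - b with hwdef
  have hspec : w = (PadicInt.unitCoeff hw0 : ℤ_[p]) * (p : ℤ_[p]) ^ w.valuation := PadicInt.unitCoeff_spec hw0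
  set v : ℤ_[p] := (PadicInt.unitCoeff hw0 : ℤ_[p]) with hvdef
  set k : ℕ := w.valuation with hkdef
  -- `h = (1+x)^v` is a `p^k`-th root of unity of level `< ‖p‖`
  set h : ℂ_[p] := onePlusPow v x with hhdef
  have hhpow : h ^ (p ^ k) = 1 := by
    rw [hhdef, ← onePlusPow_natCast_mul (p ^ k) v hx, Nat.cast_pow, mul_comm, ← hspec, hw]
  have hh1 : ‖h - 1‖ < ‖(p : ℂ_[p])‖ := (norm_onePlusPow_sub_one_le v hx).trans_lt hxp
  have hh : h = 1 := by
    by_contra hh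
    exact forall_pow_ne_one_of_norm_sub_one_lt hh hh1 (p ^ k) (pow_pos (Fact.out : p.Prime).pos k) hhpow
  -- then `1 + x = ((1+x)^v)^{v⁻¹} = 1`
  have hunit : IsUnit v := (PadicInt.unitCoeff hw0).isUnit
  obtain ⟨vi, hvi⟩ := hunit.exists_left_inv
  have h1x : onePlusPow (1 : ℤ_[p]) x = 1 := by
    rw [← hvi, mul_comm, onePlusPow_mul v vi hx, ← hhdef, hh, sub_self, onePlusPow_at_zero]
  rw [onePlusPow_one] at h1x
  exact hx0 (by linear_combination h1x)

/-- Equality of exponents from equality of powers of a one-unit `u ≠ 1` of level `‖u − 1‖ < ‖p‖`: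
`u^a = u^b ⟹ a = b`. [cite: Serre1973, Ch. II §3.2 Prop. 8] -/
theorem eq_of_onePlusPow_eq {u : ℂ_[p]} (hu1 : u ≠ 1) (hup : ‖u - 1‖ < ‖(p : ℂ_[p])‖) {a b : ℤ_[p]}
    (h : onePlusPow a (u - 1) = onePlusPow b (u - 1)) : a = b :=
  onePlusPow_injective_of_norm_lt (sub_ne_zero.2 hu1) hup h

end Literature.NumberTheory.EllipticCurves.IntSeries

end
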